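import Mathlib.Analysis.SpecialFunctions.Gamma.Digamma
import Mathlib.Analysis.SpecialFunctions.Gamma.Beta
import Mathlib.Analysis.Complex.LocallyUniformLimit
import Mathlib.Analysis.SumIntegralComparisons
import Mathlib.Analysis.SpecialFunctions.Integrals.Basic
import Mathlib.Analysis.SpecialFunctions.Trigonometric.ArctanDeriv
import Mathlib.Analysis.PSeries
import Mathlib.NumberTheory.Harmonic.EulerMascheroni
import HarnessLib

/-!
# Gauss's limit formula for the digamma function and a bound on vertical lines

Trunk T-ANALYSIS support (special functions, `Literature/Analysis/SpecialFunctions`). Leaf B1 of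
the decomposition of `Literature.NumberTheory.LFunctions.speiser_iff` (Levinson–Montgomery 1974, (2.4): a Stirling-type
estimate for `Re Γ'/Γ` on vertical lines is what makes `Re ζ'/ζ < 0` on the edges of their
contour). Mathlib (this tree's pin) defines `Complex.digamma = logDeriv Gamma` and knows its values
at `1` and `1/2` and the recurrence, but neither the series of Andrews–Askey–Roy Thm. 1.2.5
(1.2.13) nor any estimate of `ψ` off the real axis. This file proves, for `0 < Re w`:

* `Literature.Analysis.SpecialFunctions.Complex.tendstoUniformlyOn_GammaSeq` — Euler's sequence `GammaSeq s n = nˢ n!/(s(s+1)⋯(s+n))`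
  converges to `Γ(s)` **uniformly** on closed vertical strips `0 < σ₁ ≤ Re s ≤ σ₂` (Mathlib:
  pointwise, `Complex.GammaSeq_tendsto_Gamma`), hence locally uniformly on `Re s > 0`
  (`Literature.Analysis.SpecialFunctions.Complex.tendstoLocallyUniformlyOn_GammaSeq`);
* `Literature.Analysis.SpecialFunctions.Complex.tendsto_log_sub_sum_inv_digamma` — **Gauss's formula**
  `ψ(w) = lim_{n→∞} (log n − Σ_{j=0}^{n} 1/(w+j))` (logarithmic derivative of Euler's formula,
  via `Complex.logDeriv_tendsto`), and the series form of Andrews–Askey–Roy (1.2.13):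
  `Literature.Analysis.SpecialFunctions.Complex.hasSum_one_div_sub_one_div_digamma`,
  `Σ_{k≥0} (1/(k+1) − 1/(w+k)) = ψ(w) + γ`;
* `Literature.Analysis.SpecialFunctions.Complex.abs_re_digamma_sub_log_norm_le` — the explicit Stirling-type vertical bound
  `|Re ψ(w) − log ‖w‖| ≤ 1/(2‖w‖²) + π/(4|Im w|)` (`0 < Re w`, `Im w ≠ 0`), obtained from Gauss's
  formula by comparing `Σ_{j<n} Re 1/(w+j)` with `∫₀ⁿ Re 1/(w+u) du = log‖w+n‖ − log‖w‖`
  interval by interval (`|Re 1/(w+j) − ∫ⱼ^{j+1} Re 1/(w+u) du| ≤ 1/(2‖w+j‖²)` and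
  `Σ_j 1/‖w+j‖² ≤ 1/‖w‖² + π/(2|Im w|)`); one-sided forms `log_norm_sub_le_re_digamma`,
  `re_digamma_le_log_norm_add`. (Levinson–Montgomery (2.4) quote the sharper Stirling form
  `Re Γ'/Γ(s/2+1) = log|(s+2)/2| − Re((1−is)/|s+2|²) + R₁`, `|R₁| ≤ 5|s+2|⁻²`; the present bound,
  e.g. `Re ψ(1+5i) ≥ log √26 − 1/52 − π/20 > 1.45`, is what the sign lemmas of the `speiser_iff`
  route consume.)

## References

* G. E. Andrews, R. Askey, R. Roy, *Special Functions*, Encyclopedia Math. Appl. 71, CUP 1999,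
  §1.2, Thm. 1.2.5, (1.2.13).
* N. Levinson, H. L. Montgomery, *Zeros of the derivatives of the Riemann zeta-function*, Acta
  Math. 133 (1974), 49–65, (2.4).
-/

noncomputable section

open Complex Filter Topology Set MeasureTheory intervalIntegral
open scoped Real

namespace Literature.Analysis.SpecialFunctions.Complex

/-! ### Uniform convergence of Euler's sequence on vertical strips -/

/-- The majorant `x^{σ₁-1} + x^{σ₂-1}` of `|x^{s-1}| = x^{Re s - 1}` on the strip
`σ₁ ≤ Re s ≤ σ₂`, `x > 0`. [folklore] -/
lemma rpow_re_sub_one_le {σ₁ σ₂ : ℝ} {s : ℂ} (h₁ : σ₁ ≤ s.re) (h₂ : s.re ≤ σ₂) {x : ℝ}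
    (hx : 0 < x) : x ^ (s.re - 1) ≤ x ^ (σ₁ - 1) + x ^ (σ₂ - 1) := by
  rcases le_or_gt 1 x with hx1 | hx1
  · calc x ^ (s.re - 1) ≤ x ^ (σ₂ - 1) := Real.rpow_le_rpow_of_exponent_le hx1 (by linarith)
      _ ≤ x ^ (σ₁ - 1) + x ^ (σ₂ - 1) := le_add_of_nonneg_left (Real.rpow_nonneg hx.le _)
  · calc x ^ (s.re - 1) ≤ x ^ (σ₁ - 1) :=
        Real.rpow_le_rpow_of_exponent_ge hx hx1.le (by linarith)
      _ ≤ x ^ (σ₁ - 1) + x ^ (σ₂ - 1) := le_add_of_nonneg_right (Real.rpow_nonneg hx.le _)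

/-- The truncated kernel `𝟙_{(0,n]}(x) (1 - x/n)ⁿ` of Euler's sequence. [folklore] -/
def eulerKernel (n : ℕ) (x : ℝ) : ℝ :=
  indicator (Ioc 0 (n : ℝ)) (fun x : ℝ ↦ (1 - x / n) ^ n) x

/-- `0 ≤ 𝟙_{(0,n]}(x)(1-x/n)ⁿ ≤ e^{-x}` for `x > 0`. [folklore] -/
lemma eulerKernel_mem_Icc (n : ℕ) {x : ℝ} (hx : 0 < x) :
    eulerKernel n x ∈ Icc 0 (Real.exp (-x)) := by
  unfold eulerKernel
  rcases le_or_gt x n with hxn | hxn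
  · rw [indicator_of_mem (mem_Ioc.2 ⟨hx, hxn⟩)]
    exact ⟨pow_nonneg (sub_nonneg.2 (div_le_one_of_le₀ hxn (Nat.cast_nonneg n))) _,
      Real.one_sub_div_pow_le_exp_neg hxn⟩
  · rw [indicator_of_notMem (fun h ↦ (not_le.2 hxn) h.2)]
    exact ⟨le_rfl, (Real.exp_pos _).le⟩

/-- `|𝟙_{(0,n]}(x)(1-x/n)ⁿ − e^{−x}| ≤ e^{−x}` for `x > 0`. [folklore] -/
lemma abs_eulerKernel_sub_exp_le (n : ℕ) {x : ℝ} (hx : 0 < x) :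
    |eulerKernel n x - Real.exp (-x)| ≤ Real.exp (-x) := by
  obtain ⟨h0, h1⟩ := eulerKernel_mem_Icc n hx
  rw [abs_sub_comm, abs_of_nonneg (by linarith)]
  linarith

/-- Pointwise convergence `𝟙_{(0,n]}(x)(1-x/n)ⁿ → e^{−x}`. [folklore] -/
lemma tendsto_eulerKernel {x : ℝ} (hx : 0 < x) :
    Tendsto (fun n ↦ eulerKernel n x) atTop (𝓝 (Real.exp (-x))) := by
  apply Tendsto.congr'
  · change ∀ᶠ n : ℕ in atTop, (1 - x / n) ^ n = eulerKernel n x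
    filter_upwards [eventually_ge_atTop ⌈x⌉₊] with n hn
    rw [Nat.ceil_le] at hn
    unfold eulerKernel
    rw [indicator_of_mem (mem_Ioc.2 ⟨hx, hn⟩)]
  · convert Real.tendsto_one_add_div_pow_exp (-x) using 1
    ext1 n
    rw [neg_div, ← sub_eq_add_neg]

/-- The kernel is measurable in `x`. [folklore] -/
lemma measurable_eulerKernel (n : ℕ) : Measurable (eulerKernel n) := by
  unfold eulerKernel
  exact (Measurable.indicator (by fun_prop) measurableSet_Ioc)

/-- Euler's sequence as an integral over `(0, ∞)` against the truncated kernel, `0 < Re s`,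
`n ≠ 0` (Mathlib's `Complex.GammaSeq_eq_approx_Gamma_integral`, rewritten). [folklore] -/
lemma GammaSeq_eq_integral_eulerKernel {s : ℂ} (hs : 0 < s.re) {n : ℕ} (hn : n ≠ 0) :
    GammaSeq s n = ∫ x in Ioi (0 : ℝ), (eulerKernel n x : ℂ) * (x : ℂ) ^ (s - 1) := by
  rw [GammaSeq_eq_approx_Gamma_integral hs hn, intervalIntegral.integral_of_le (Nat.cast_nonneg n)]
  have hpt : (fun x : ℝ ↦ (eulerKernel n x : ℂ) * (x : ℂ) ^ (s - 1)) =
      indicator (Ioc 0 (n : ℝ)) (fun x : ℝ ↦ (((1 - x / n) ^ n : ℝ) : ℂ) * (x : ℂ) ^ (s - 1)) := by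
    funext x
    unfold eulerKernel
    by_cases h : x ∈ Ioc (0 : ℝ) n
    · rw [indicator_of_mem h, indicator_of_mem h]
    · rw [indicator_of_notMem h, indicator_of_notMem h]
      simp
  rw [hpt, setIntegral_indicator measurableSet_Ioc, inter_eq_right.2 Ioc_subset_Ioi_self]

/-- The strip error `ε_n = ∫₀^∞ |𝟙_{(0,n]}(x)(1-x/n)ⁿ − e^{−x}| (x^{σ₁-1} + x^{σ₂-1}) dx`. [folklore] -/
def eulerError (σ₁ σ₂ : ℝ) (n : ℕ) : ℝ :=
  ∫ x in Ioi (0 : ℝ), |eulerKernel n x - Real.exp (-x)| * (x ^ (σ₁ - 1) + x ^ (σ₂ - 1))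

/-- The dominating function `e^{-x}(x^{σ₁-1} + x^{σ₂-1})` is integrable on `(0,∞)` for
`0 < σ₁, σ₂`. [folklore] -/
lemma integrableOn_exp_mul_rpow_add {σ₁ σ₂ : ℝ} (h₁ : 0 < σ₁) (h₂ : 0 < σ₂) :
    IntegrableOn (fun x : ℝ ↦ Real.exp (-x) * (x ^ (σ₁ - 1) + x ^ (σ₂ - 1))) (Ioi 0) := by
  have := (Real.GammaIntegral_convergent h₁).add (Real.GammaIntegral_convergent h₂)
  refine this.congr_fun (fun x _ ↦ ?_) measurableSet_Ioi
  simp only [Pi.add_apply]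
  ring

/-- Measurability of the integrand of `ε_n`. [folklore] -/
lemma aestronglyMeasurable_eulerError_integrand {σ₁ σ₂ : ℝ} (n : ℕ) {μ : Measure ℝ} :
    AEStronglyMeasurable
      (fun x : ℝ ↦ |eulerKernel n x - Real.exp (-x)| * (x ^ (σ₁ - 1) + x ^ (σ₂ - 1))) μ := by
  refine Measurable.aestronglyMeasurable ?_
  have h1 : Measurable (fun x : ℝ ↦ eulerKernel n x - Real.exp (-x)) :=
    (measurable_eulerKernel n).sub (Real.continuous_exp.comp continuous_neg).measurable
  have h2 : Measurable (fun x : ℝ ↦ |eulerKernel n x - Real.exp (-x)|) :=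
    continuous_abs.measurable.comp h1
  exact h2.mul ((measurable_id.pow_const _).add (measurable_id.pow_const _))

/-- `ε_n → 0` (dominated convergence). [folklore] -/
lemma tendsto_eulerError {σ₁ σ₂ : ℝ} (h₁ : 0 < σ₁) (h₂ : 0 < σ₂) :
    Tendsto (eulerError σ₁ σ₂) atTop (𝓝 0) := by
  have hlim : Tendsto (eulerError σ₁ σ₂) atTop
      (𝓝 (∫ x in Ioi (0 : ℝ), (0 : ℝ) * (x ^ (σ₁ - 1) + x ^ (σ₂ - 1)))) := by
    refine tendsto_integral_of_dominated_convergence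
      (fun x ↦ Real.exp (-x) * (x ^ (σ₁ - 1) + x ^ (σ₂ - 1))) (fun n ↦ ?_)
      (integrableOn_exp_mul_rpow_add h₁ h₂) (fun n ↦ ?_) ?_
    · exact aestronglyMeasurable_eulerError_integrand n
    · rw [ae_restrict_iff' measurableSet_Ioi]
      filter_upwards with x hx
      have hb : 0 ≤ x ^ (σ₁ - 1) + x ^ (σ₂ - 1) :=
        add_nonneg (Real.rpow_nonneg hx.out.le _) (Real.rpow_nonneg hx.out.le _)
      rw [Real.norm_of_nonneg (mul_nonneg (abs_nonneg _) hb)]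
      exact mul_le_mul_of_nonneg_right (abs_eulerKernel_sub_exp_le n hx) hb
    · rw [ae_restrict_iff' measurableSet_Ioi]
      filter_upwards with x hx
      refine Tendsto.mul ?_ tendsto_const_nhds
      have := ((tendsto_eulerKernel hx).sub_const (Real.exp (-x))).abs
      simpa using this
  simpa using hlim

/-- **Uniform error bound on a strip.** For `0 < σ₁ ≤ Re s ≤ σ₂` and `n ≠ 0`,
`‖GammaSeq s n − Γ(s)‖ ≤ ε_n`. [folklore] -/
lemma norm_GammaSeq_sub_Gamma_le {σ₁ σ₂ : ℝ} (h₁ : 0 < σ₁) {s : ℂ} (hs₁ : σ₁ ≤ s.re)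
    (hs₂ : s.re ≤ σ₂) {n : ℕ} (hn : n ≠ 0) :
    ‖GammaSeq s n - Gamma s‖ ≤ eulerError σ₁ σ₂ n := by
  have hs : 0 < s.re := h₁.trans_le hs₁
  have h₂ : 0 < σ₂ := hs.trans_le hs₂
  -- integrability of the two integrands
  have hΓ : IntegrableOn (fun x : ℝ ↦ (Real.exp (-x) : ℂ) * (x : ℂ) ^ (s - 1)) (Ioi 0) := by
    have := Complex.GammaIntegral_convergent hs
    refine this.congr_fun (fun x _ ↦ ?_) measurableSet_Ioi
    simp
  have hcpow : ContinuousOn (fun x : ℝ ↦ (x : ℂ) ^ (s - 1)) (Ioi 0) := by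
    intro x hx
    exact ((continuousAt_cpow_const (ofReal_mem_slitPlane.2 hx)).comp
      continuous_ofReal.continuousAt).continuousWithinAt
  have hK_meas : AEStronglyMeasurable (fun x : ℝ ↦ (eulerKernel n x : ℂ) * (x : ℂ) ^ (s - 1))
      (volume.restrict (Ioi 0)) := by
    refine ((continuous_ofReal.measurable.comp (measurable_eulerKernel n)).aestronglyMeasurable).mul
      (hcpow.aestronglyMeasurable measurableSet_Ioi)
  have hK : IntegrableOn (fun x : ℝ ↦ (eulerKernel n x : ℂ) * (x : ℂ) ^ (s - 1)) (Ioi 0) := by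
    refine Integrable.mono' (hΓ.norm) hK_meas ?_
    rw [ae_restrict_iff' measurableSet_Ioi]
    filter_upwards with x hx
    obtain ⟨h0, h1⟩ := eulerKernel_mem_Icc n hx
    rw [norm_mul, norm_mul, Complex.norm_of_nonneg h0, Complex.norm_of_nonneg (Real.exp_pos _).le]
    exact mul_le_mul_of_nonneg_right h1 (norm_nonneg _)
  rw [GammaSeq_eq_integral_eulerKernel hs hn, Gamma_eq_integral hs, Complex.GammaIntegral,
    ← integral_sub hK hΓ]
  refine (MeasureTheory.norm_integral_le_integral_norm _).trans ?_
  unfold eulerError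
  refine setIntegral_mono_on ?_ ?_ measurableSet_Ioi fun x hx ↦ ?_
  · exact (hK.sub hΓ).norm
  · refine Integrable.mono' (integrableOn_exp_mul_rpow_add h₁ h₂)
      (aestronglyMeasurable_eulerError_integrand n) ?_
    rw [ae_restrict_iff' measurableSet_Ioi]
    filter_upwards with y hy
    have hb : 0 ≤ y ^ (σ₁ - 1) + y ^ (σ₂ - 1) :=
      add_nonneg (Real.rpow_nonneg hy.out.le _) (Real.rpow_nonneg hy.out.le _)
    rw [Real.norm_of_nonneg (mul_nonneg (abs_nonneg _) hb)]
    exact mul_le_mul_of_nonneg_right (abs_eulerKernel_sub_exp_le n hy) hb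
  · rw [← sub_mul, norm_mul, norm_cpow_eq_rpow_re_of_pos hx, sub_re, one_re]
    have : ‖(eulerKernel n x : ℂ) - (Real.exp (-x) : ℂ)‖ = |eulerKernel n x - Real.exp (-x)| := by
      rw [← ofReal_sub, Complex.norm_real, Real.norm_eq_abs]
    rw [this]
    exact mul_le_mul_of_nonneg_left (rpow_re_sub_one_le hs₁ hs₂ hx) (abs_nonneg _)

/-- **Euler's limit formula, uniformly on vertical strips.** For `0 < σ₁ ≤ σ₂`,
`GammaSeq s n → Γ(s)` uniformly in `σ₁ ≤ Re s ≤ σ₂` (Mathlib has the pointwise statement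
`Complex.GammaSeq_tendsto_Gamma`). [folklore] -/
theorem tendstoUniformlyOn_GammaSeq {σ₁ σ₂ : ℝ} (h₁ : 0 < σ₁) (h₂ : 0 < σ₂) :
    TendstoUniformlyOn (fun (n : ℕ) (s : ℂ) ↦ GammaSeq s n) Gamma atTop
      {s : ℂ | σ₁ ≤ s.re ∧ s.re ≤ σ₂} := by
  rw [Metric.tendstoUniformlyOn_iff]
  intro ε hε
  filter_upwards [(tendsto_eulerError h₁ h₂).eventually (gt_mem_nhds hε),
    eventually_ne_atTop 0] with n hn hn0 s hs
  rw [dist_comm, dist_eq_norm]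
  exact (norm_GammaSeq_sub_Gamma_le h₁ hs.1 hs.2 hn0).trans_lt hn

/-- Euler's limit formula holds locally uniformly on the right half-plane `Re s > 0`. [folklore] -/
theorem tendstoLocallyUniformlyOn_GammaSeq :
    TendstoLocallyUniformlyOn (fun (n : ℕ) (s : ℂ) ↦ GammaSeq s n) Gamma atTop
      {s : ℂ | 0 < s.re} := by
  have hopen : IsOpen {s : ℂ | 0 < s.re} := isOpen_lt continuous_const continuous_re
  rw [tendstoLocallyUniformlyOn_iff_forall_isCompact hopen]
  intro K hKU hK
  rcases K.eq_empty_or_nonempty with rfl | hne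
  · exact tendstoUniformlyOn_empty
  obtain ⟨z₁, hz₁, hmin⟩ := hK.exists_isMinOn hne continuous_re.continuousOn
  obtain ⟨z₂, hz₂, hmax⟩ := hK.exists_isMaxOn hne continuous_re.continuousOn
  have h₁ : 0 < z₁.re := hKU hz₁
  have h₂ : 0 < z₂.re := hKU hz₂
  exact (tendstoUniformlyOn_GammaSeq h₁ h₂).mono fun s hs ↦ ⟨hmin hs, hmax hs⟩

/-! ### Gauss's formula for `ψ` -/

/-- Euler's sequence is complex differentiable in `s` on `Re s > 0` (`n ≠ 0`). [folklore] -/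
lemma differentiableOn_GammaSeq {n : ℕ} (hn : n ≠ 0) :
    DifferentiableOn ℂ (fun s : ℂ ↦ GammaSeq s n) {s : ℂ | 0 < s.re} := by
  intro s hs
  have hprod : ∏ j ∈ Finset.range (n + 1), (s + j) ≠ 0 := by
    rw [Finset.prod_ne_zero_iff]
    intro j _ h
    have := congrArg re h
    simp at this
    linarith [hs.out]
  unfold GammaSeq
  refine DifferentiableAt.differentiableWithinAt ?_
  refine DifferentiableAt.div ?_ ?_ hprod
  · exact (differentiableAt_id.const_cpow (Or.inl (Nat.cast_ne_zero.2 hn))).mul_const _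
  · exact DifferentiableAt.fun_finsetProd fun j _ ↦ (differentiableAt_fun_id.add_const (j : ℂ))

/-- The logarithmic derivative of Euler's sequence: for `Re s > 0` and `n ≠ 0`,
`(d/ds) log GammaSeq s n = log n − Σ_{j=0}^{n} 1/(s+j)`. [folklore] -/
lemma logDeriv_GammaSeq {n : ℕ} (hn : n ≠ 0) {s : ℂ} (hs : 0 < s.re) :
    logDeriv (fun s : ℂ ↦ GammaSeq s n) s =
      (Real.log n : ℂ) - ∑ j ∈ Finset.range (n + 1), 1 / (s + j) := by
  have hn' : (n : ℂ) ≠ 0 := Nat.cast_ne_zero.2 hn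
  have hfac : ∀ j ∈ Finset.range (n + 1), s + j ≠ 0 := by
    intro j _ h
    have := congrArg re h
    simp at this
    linarith
  have hprod : ∏ j ∈ Finset.range (n + 1), (s + j) ≠ 0 := Finset.prod_ne_zero_iff.2 hfac
  have hnum : (n : ℂ) ^ s * n.factorial ≠ 0 :=
    mul_ne_zero (by simp [cpow_eq_zero_iff, hn']) (by exact_mod_cast Nat.factorial_ne_zero n)
  have hd_num : DifferentiableAt ℂ (fun s : ℂ ↦ (n : ℂ) ^ s * n.factorial) s :=
    (differentiableAt_id.const_cpow (Or.inl hn')).mul_const _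
  have hd_den : DifferentiableAt ℂ (fun s : ℂ ↦ ∏ j ∈ Finset.range (n + 1), (s + j)) s :=
    DifferentiableAt.fun_finsetProd fun j _ ↦ (differentiableAt_fun_id.add_const (j : ℂ))
  have h1 : logDeriv (fun s : ℂ ↦ GammaSeq s n) s =
      logDeriv (fun s : ℂ ↦ (n : ℂ) ^ s * n.factorial) s -
        logDeriv (fun s : ℂ ↦ ∏ j ∈ Finset.range (n + 1), (s + j)) s := by
    have : (fun s : ℂ ↦ GammaSeq s n) =
        fun s : ℂ ↦ ((n : ℂ) ^ s * n.factorial) / ∏ j ∈ Finset.range (n + 1), (s + (j : ℂ)) := rfl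
    rw [this, logDeriv_div s hnum hprod hd_num hd_den]
  have h2 : logDeriv (fun s : ℂ ↦ (n : ℂ) ^ s * n.factorial) s = (Real.log n : ℂ) := by
    rw [logDeriv_mul_const s (n.factorial : ℂ) (by exact_mod_cast Nat.factorial_ne_zero n),
      logDeriv_apply,
      ((hasStrictDerivAt_const_cpow (Or.inl hn')).hasDerivAt).deriv,
      mul_div_cancel_left₀ _ (by simp [cpow_eq_zero_iff, hn']), Complex.natCast_log]
  have h3 : logDeriv (fun s : ℂ ↦ ∏ j ∈ Finset.range (n + 1), (s + j)) s =
      ∑ j ∈ Finset.range (n + 1), 1 / (s + j) := by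
    rw [logDeriv_prod (f := fun (j : ℕ) (z : ℂ) ↦ z + j) (x := s) hfac
      (fun j _ ↦ differentiableAt_fun_id.add_const (j : ℂ))]
    refine Finset.sum_congr rfl fun j _ ↦ ?_
    rw [logDeriv_apply, deriv_add_const, deriv_id'']
  rw [h1, h2, h3]

/-- **Gauss's formula for the digamma function.** For `0 < Re w`,
`ψ(w) = lim_{n→∞} (log n − Σ_{j=0}^{n} 1/(w+j))` (logarithmic derivative of Euler's limit
formula; equivalent to Andrews–Askey–Roy (1.2.13) since `H_n − log n → γ`).
[cite: AndrewsAskeyRoy1999, Thm 1.2.5 (1.2.13)] -/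
theorem tendsto_log_sub_sum_inv_digamma {w : ℂ} (hw : 0 < w.re) :
    Tendsto (fun n : ℕ ↦ (Real.log n : ℂ) - ∑ j ∈ Finset.range (n + 1), 1 / (w + j)) atTop
      (𝓝 (digamma w)) := by
  have hopen : IsOpen {s : ℂ | 0 < s.re} := isOpen_lt continuous_const continuous_re
  have hdiff : ∀ᶠ n : ℕ in atTop, DifferentiableOn ℂ (fun s : ℂ ↦ GammaSeq s n) {s : ℂ | 0 < s.re} := by
    filter_upwards [eventually_ne_atTop 0] with n hn using differentiableOn_GammaSeq hn
  have h := Complex.logDeriv_tendsto hopen hw tendstoLocallyUniformlyOn_GammaSeq hdiff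
    (Gamma_ne_zero_of_re_pos hw)
  rw [digamma_def]
  refine h.congr' ?_
  filter_upwards [eventually_ne_atTop 0] with n hn using logDeriv_GammaSeq hn hw

/-- The terms of the series (1.2.13): `1/(k+1) − 1/(w+k) = (w-1)/((k+1)(w+k))`, of norm at most
`‖w-1‖/(min(Re w,1)·(k+1)²)` for `0 < Re w`. [folklore] -/
lemma norm_one_div_sub_one_div_le {w : ℂ} (hw : 0 < w.re) (k : ℕ) :
    ‖1 / ((k : ℂ) + 1) - 1 / (w + k)‖ ≤ ‖w - 1‖ / (min w.re 1 * ((k : ℝ) + 1) ^ 2) := by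
  have hk1 : (0 : ℝ) < (k : ℝ) + 1 := by positivity
  have hwk : w + k ≠ 0 := by
    intro h; have := congrArg re h; simp at this; linarith
  have hk1' : (k : ℂ) + 1 ≠ 0 := by exact_mod_cast hk1.ne'
  have heq : 1 / ((k : ℂ) + 1) - 1 / (w + k) = (w - 1) / (((k : ℂ) + 1) * (w + k)) := by
    field_simp
    ring
  rw [heq, norm_div, norm_mul]
  have hnk : ‖(k : ℂ) + 1‖ = (k : ℝ) + 1 := by
    rw [show ((k : ℂ) + 1) = ((k + 1 : ℝ) : ℂ) by push_cast; ring, Complex.norm_real,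
      Real.norm_of_nonneg hk1.le]
  have hwk_ge : min w.re 1 * ((k : ℝ) + 1) ≤ ‖w + k‖ := by
    calc min w.re 1 * ((k : ℝ) + 1) = min w.re 1 * k + min w.re 1 := by ring
      _ ≤ 1 * k + w.re := add_le_add
          (mul_le_mul_of_nonneg_right (min_le_right _ _) (Nat.cast_nonneg k)) (min_le_left _ _)
      _ = (w + k).re := by simp; ring
      _ ≤ ‖w + k‖ := re_le_norm _
  have hmin : 0 < min w.re 1 := lt_min hw one_pos
  rw [hnk]
  calc ‖w - 1‖ / (((k : ℝ) + 1) * ‖w + ↑k‖)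
      ≤ ‖w - 1‖ / (((k : ℝ) + 1) * (min w.re 1 * ((k : ℝ) + 1))) := by
        gcongr
    _ = ‖w - 1‖ / (min w.re 1 * ((k : ℝ) + 1) ^ 2) := by ring

/-- **Andrews–Askey–Roy, Thm. 1.2.5 (1.2.13)**, for `0 < Re w`:
`Σ_{k=0}^{∞} (1/(k+1) − 1/(w+k)) = ψ(w) − ψ(1) = ψ(w) + γ`. [cite: AndrewsAskeyRoy1999, Thm 1.2.5 (1.2.13)] -/
theorem hasSum_one_div_sub_one_div_digamma {w : ℂ} (hw : 0 < w.re) :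
    HasSum (fun k : ℕ ↦ 1 / ((k : ℂ) + 1) - 1 / (w + k))
      (digamma w + Real.eulerMascheroniConstant) := by
  -- absolute convergence
  have hsumm : Summable (fun k : ℕ ↦ 1 / ((k : ℂ) + 1) - 1 / (w + k)) := by
    refine Summable.of_norm_bounded (g := fun k : ℕ ↦ ‖w - 1‖ / (min w.re 1 * ((k : ℝ) + 1) ^ 2))
      ?_ (norm_one_div_sub_one_div_le hw)
    have : Summable (fun k : ℕ ↦ 1 / ((k : ℝ) + 1) ^ 2) := by
      have h := (Real.summable_one_div_nat_pow.2 one_lt_two)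
      exact_mod_cast (summable_nat_add_iff 1).2 h
    refine (this.mul_left (‖w - 1‖ / min w.re 1)).congr fun k ↦ ?_
    field_simp
  -- identification of the sum through the partial sums
  rw [hsumm.hasSum_iff_tendsto_nat]
  have hharm : ∀ n : ℕ, ∑ k ∈ Finset.range n, (1 / ((k : ℂ) + 1)) = ((harmonic n : ℝ) : ℂ) := by
    intro n
    induction n with
    | zero => simp
    | succ m ih =>
      rw [Finset.sum_range_succ, ih, harmonic_succ]
      push_cast
      ring
  have hpartial : ∀ n : ℕ, ∑ k ∈ Finset.range (n + 1), (1 / ((k : ℂ) + 1) - 1 / (w + k)) =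
      (((harmonic (n + 1) : ℝ) - Real.log ((n : ℝ) + 1) : ℝ) : ℂ) +
        ((Real.log ((n : ℝ) + 1) - Real.log n : ℝ) : ℂ) +
        ((Real.log n : ℂ) - ∑ j ∈ Finset.range (n + 1), 1 / (w + j)) := by
    intro n
    rw [Finset.sum_sub_distrib, hharm]
    push_cast
    ring
  -- shift the index by one and use `H_{n+1} − log(n+1) → γ`, `log(n+1) − log n → 0`
  rw [← tendsto_add_atTop_iff_nat 1]
  simp_rw [hpartial]
  have hγ : Tendsto (fun n : ℕ ↦ (((harmonic (n + 1) : ℝ) - Real.log ((n : ℝ) + 1) : ℝ) : ℂ))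
      atTop (𝓝 (Real.eulerMascheroniConstant : ℂ)) := by
    have h := (Real.tendsto_harmonic_sub_log_add_one).comp (tendsto_add_atTop_nat 1)
    have h' : Tendsto (fun n : ℕ ↦ (harmonic (n + 1) : ℝ) - Real.log ((n : ℝ) + 1)) atTop
        (𝓝 Real.eulerMascheroniConstant) := by
      refine (Real.tendsto_harmonic_sub_log.comp (tendsto_add_atTop_nat 1)).congr fun n ↦ ?_
      simp
    exact (continuous_ofReal.tendsto _).comp h'
  have hlog : Tendsto (fun n : ℕ ↦ ((Real.log ((n : ℝ) + 1) - Real.log n : ℝ) : ℂ)) atTop (𝓝 0) := by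
    have h1 : Tendsto (fun n : ℕ ↦ Real.log ((n : ℝ) + 1) - Real.log n) atTop (𝓝 0) :=
      (Real.tendsto_log_comp_add_sub_log 1).comp tendsto_natCast_atTop_atTop
    have := (continuous_ofReal.tendsto 0).comp h1
    simpa only [Function.comp_def, ofReal_zero] using this
  have := (hγ.add hlog).add (tendsto_log_sub_sum_inv_digamma hw)
  simp only [add_zero] at this
  convert this using 2
  ring

/-! ### A Stirling-type bound for `Re ψ` off the real axis -/

/-- `Re (1/(w+u)) = (Re w + u)/((Re w + u)² + (Im w)²)`. [folklore] -/
lemma re_one_div_add_ofReal (w : ℂ) (u : ℝ) :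
    (1 / (w + u)).re = (w.re + u) / ((w.re + u) ^ 2 + w.im ^ 2) := by
  rw [one_div, inv_re, normSq_apply]
  simp only [add_re, ofReal_re, add_im, ofReal_im, add_zero]
  ring_nf

/-- `‖w + u‖² = (Re w + u)² + (Im w)²`. [folklore] -/
lemma norm_add_ofReal_sq (w : ℂ) (u : ℝ) : ‖w + u‖ ^ 2 = (w.re + u) ^ 2 + w.im ^ 2 := by
  rw [Complex.sq_norm, normSq_apply]
  simp only [add_re, ofReal_re, add_im, ofReal_im, add_zero]
  ring

/-- `w + u ≠ 0` for `0 < Re w`, `0 ≤ u`. [folklore] -/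
lemma norm_add_ofReal_pos {w : ℂ} (hw : 0 < w.re) {u : ℝ} (hu : 0 ≤ u) : 0 < ‖w + u‖ := by
  refine norm_pos_iff.2 fun h ↦ ?_
  have := congrArg Complex.re h
  simp at this
  linarith

/-- `∫₀ⁿ Re (1/(w+u)) du = log ‖w + n‖ − log ‖w‖` (`0 < Re w`). [folklore] -/
lemma integral_re_one_div_add {w : ℂ} (hw : 0 < w.re) {a b : ℝ} (ha : 0 ≤ a) (hb : 0 ≤ b) :
    ∫ u in a..b, (1 / (w + u)).re = Real.log ‖w + b‖ - Real.log ‖w + a‖ := by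
  have hpos : ∀ u : ℝ, 0 ≤ u → 0 < (w.re + u) ^ 2 + w.im ^ 2 := fun u hu ↦ by positivity
  have hlog : ∀ u : ℝ, 0 ≤ u → Real.log ‖w + u‖ = (1 / 2) * Real.log ((w.re + u) ^ 2 + w.im ^ 2) := by
    intro u hu
    rw [← norm_add_ofReal_sq, Real.log_pow]
    ring
  rw [hlog b hb, hlog a ha]
  have hderiv : ∀ u ∈ uIcc a b,
      HasDerivAt (fun u : ℝ ↦ (1 / 2) * Real.log ((w.re + u) ^ 2 + w.im ^ 2)) ((1 / (w + u)).re) u := by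
    intro u hu
    have hu0 : 0 ≤ u := by
      rcases mem_uIcc.1 hu with h | h <;> linarith [h.1]
    have h1 : HasDerivAt (fun u : ℝ ↦ (w.re + u) ^ 2 + w.im ^ 2) (2 * (w.re + u)) u := by
      have := ((hasDerivAt_id u).const_add w.re).pow 2
      simpa using this.add_const (w.im ^ 2)
    have h2 := (h1.log (hpos u hu0).ne').const_mul (1 / 2)
    refine h2.congr_deriv ?_
    rw [re_one_div_add_ofReal]
    field_simp
  have hcont : ContinuousOn (fun u : ℝ ↦ (1 / (w + u)).re) (uIcc a b) := by
    refine continuous_re.comp_continuousOn (ContinuousOn.div continuousOn_const (by fun_prop) ?_)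
    intro u hu h
    have hu0 : 0 ≤ u := by
      rcases mem_uIcc.1 hu with h' | h' <;> linarith [h'.1]
    have := congrArg Complex.re h
    simp at this
    linarith
  exact integral_eq_sub_of_hasDerivAt hderiv (hcont.intervalIntegrable)

/-- For `0 < Re w`, `0 ≤ j ≤ u`: `|Re (1/(w+j)) − Re (1/(w+u))| ≤ (u − j)/‖w + j‖²`. [folklore] -/
lemma abs_re_one_div_sub_le {w : ℂ} (hw : 0 < w.re) {j u : ℝ} (hj : 0 ≤ j) (hju : j ≤ u) :
    |(1 / (w + j)).re - (1 / (w + u)).re| ≤ (u - j) / ‖w + j‖ ^ 2 := by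
  have hj0 : w + j ≠ 0 := norm_pos_iff.1 (norm_add_ofReal_pos hw hj)
  have hu0 : w + u ≠ 0 := norm_pos_iff.1 (norm_add_ofReal_pos hw (hj.trans hju))
  have hdiff : 1 / (w + j) - 1 / (w + u) = (u - j : ℂ) / ((w + j) * (w + u)) := by
    field_simp
    ring
  have hnorm : ‖w + j‖ ≤ ‖w + u‖ := by
    have h1 : ‖w + j‖ ^ 2 ≤ ‖w + u‖ ^ 2 := by
      rw [norm_add_ofReal_sq, norm_add_ofReal_sq]
      nlinarith
    exact (pow_le_pow_iff_left₀ (norm_nonneg _) (norm_nonneg _) two_ne_zero).1 h1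
  have hjpos : 0 < ‖w + j‖ := norm_add_ofReal_pos hw hj
  calc |(1 / (w + j)).re - (1 / (w + u)).re| = |(1 / (w + j) - 1 / (w + u)).re| := by
        rw [sub_re]
    _ ≤ ‖1 / (w + j) - 1 / (w + u)‖ := abs_re_le_norm _
    _ = (u - j) / (‖w + j‖ * ‖w + u‖) := by
        rw [hdiff, norm_div, norm_mul]
        congr 1
        rw [show (u - j : ℂ) = ((u - j : ℝ) : ℂ) by push_cast; ring, Complex.norm_real,
          Real.norm_eq_abs, abs_of_nonneg (by linarith)]
    _ ≤ (u - j) / (‖w + j‖ * ‖w + j‖) := by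
        gcongr
    _ = (u - j) / ‖w + j‖ ^ 2 := by rw [sq]

/-- `|Re (1/(w+j)) − ∫ⱼ^{j+1} Re (1/(w+u)) du| ≤ 1/(2‖w+j‖²)` (`0 < Re w`, `0 ≤ j`). [folklore] -/
lemma abs_re_one_div_sub_integral_le {w : ℂ} (hw : 0 < w.re) {j : ℝ} (hj : 0 ≤ j) :
    |(1 / (w + j)).re - ∫ u in j..(j + 1), (1 / (w + u)).re| ≤ 1 / (2 * ‖w + j‖ ^ 2) := by
  have hcont : ContinuousOn (fun u : ℝ ↦ (1 / (w + u)).re) (uIcc j (j + 1)) := by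
    refine continuous_re.comp_continuousOn (ContinuousOn.div continuousOn_const (by fun_prop) ?_)
    intro u hu h
    have hu0 : 0 ≤ u := by
      rcases mem_uIcc.1 hu with h' | h' <;> linarith [h'.1]
    have := congrArg Complex.re h
    simp at this
    linarith
  have hint : IntervalIntegrable (fun u : ℝ ↦ (1 / (w + u)).re) volume j (j + 1) :=
    hcont.intervalIntegrable
  have hconst : (1 / (w + j)).re = ∫ u in j..(j + 1), (1 / (w + j)).re := by simp
  rw [hconst, ← intervalIntegral.integral_sub intervalIntegrable_const hint]
  have hbound : ∀ᵐ u ∂volume, u ∈ Set.Ioc j (j + 1) →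
      ‖(1 / (w + j)).re - (1 / (w + u)).re‖ ≤ (u - j) / ‖w + j‖ ^ 2 := by
    refine ae_of_all _ fun u hu ↦ ?_
    rw [Real.norm_eq_abs]
    exact abs_re_one_div_sub_le hw hj hu.1.le
  have h := intervalIntegral.norm_integral_le_of_norm_le (by linarith) hbound
    ((continuous_sub_right (j : ℝ)).div_const _ |>.intervalIntegrable _ _)
  rw [Real.norm_eq_abs] at h
  refine h.trans (le_of_eq ?_)
  rw [intervalIntegral.integral_div, intervalIntegral.integral_sub intervalIntegrable_id
    intervalIntegrable_const, integral_id, intervalIntegral.integral_const]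
  simp only [smul_eq_mul]
  ring

/-- `∫₀^A du/(u² + y²) ≤ π/(2|y|)` for `y ≠ 0`, `0 ≤ A`. [folklore] -/
lemma integral_inv_sq_add_sq_le {y A : ℝ} (hy : y ≠ 0) (_hA : 0 ≤ A) :
    ∫ u in (0 : ℝ)..A, 1 / (u ^ 2 + y ^ 2) ≤ π / (2 * |y|) := by
  have hY : 0 < |y| := abs_pos.2 hy
  have hderiv : ∀ u ∈ uIcc 0 A,
      HasDerivAt (fun u : ℝ ↦ (1 / |y|) * Real.arctan (u / |y|)) (1 / (u ^ 2 + y ^ 2)) u := by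
    intro u _
    have h1 : HasDerivAt (fun u : ℝ ↦ u / |y|) (1 / |y|) u := by
      simpa using (hasDerivAt_id u).div_const |y|
    have h2 := ((Real.hasDerivAt_arctan (u / |y|)).comp u h1).const_mul (1 / |y|)
    refine h2.congr_deriv ?_
    have hy2 : y ^ 2 = |y| ^ 2 := (sq_abs y).symm
    rw [hy2]
    field_simp
    ring
  have hcont : ContinuousOn (fun u : ℝ ↦ 1 / (u ^ 2 + y ^ 2)) (uIcc 0 A) := by
    refine ContinuousOn.div continuousOn_const (by fun_prop) fun u _ ↦ ?_
    positivity
  rw [integral_eq_sub_of_hasDerivAt hderiv hcont.intervalIntegrable]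
  simp only [zero_div, Real.arctan_zero, mul_zero, sub_zero]
  rw [div_eq_mul_one_div π, mul_comm π, show (1 : ℝ) / (2 * |y|) * π = 1 / |y| * (π / 2) by ring]
  gcongr
  exact (Real.arctan_lt_pi_div_two _).le

/-- `Σ_{j<n} 1/‖w+j‖² ≤ 1/‖w‖² + π/(2|Im w|)` (`0 < Re w`, `Im w ≠ 0`). [folklore] -/
lemma sum_inv_norm_add_sq_le {w : ℂ} (hw : 0 < w.re) (hy : w.im ≠ 0) (n : ℕ) :
    ∑ j ∈ Finset.range n, 1 / ‖w + j‖ ^ 2 ≤ 1 / ‖w‖ ^ 2 + π / (2 * |w.im|) := by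
  rcases Nat.eq_zero_or_pos n with rfl | hn
  · simp only [Finset.range_zero, Finset.sum_empty]
    positivity
  obtain ⟨m, rfl⟩ : ∃ m, n = m + 1 := ⟨n - 1, by omega⟩
  rw [Finset.sum_range_succ']
  simp only [Nat.cast_add, Nat.cast_one, CharP.cast_eq_zero, add_zero]
  rw [add_comm]
  gcongr
  -- the terms `j ≥ 1`
  set f : ℝ → ℝ := fun u ↦ 1 / (u ^ 2 + w.im ^ 2) with hf
  have hterm : ∀ i ∈ Finset.range m, 1 / ‖w + ((i : ℂ) + 1)‖ ^ 2 ≤ f ((i + 1 : ℕ) : ℝ) := by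
    intro i _
    have hcast : w + ((i : ℂ) + 1) = w + (((i : ℝ) + 1 : ℝ) : ℂ) := by push_cast; ring
    rw [hcast, norm_add_ofReal_sq, hf]
    push_cast
    have h0 : 0 ≤ (i : ℝ) + 1 := by positivity
    have hpos : 0 < ((i : ℝ) + 1) ^ 2 + w.im ^ 2 := by positivity
    apply one_div_le_one_div_of_le hpos
    nlinarith [hw.le]
  have hanti : AntitoneOn f (Icc (0 : ℕ) (m : ℕ)) := by
    intro u hu v hv huv
    simp only [hf]
    have hu0 : (0 : ℝ) ≤ u := by exact_mod_cast hu.1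
    have hpos : 0 < u ^ 2 + w.im ^ 2 := by positivity
    gcongr
  calc ∑ i ∈ Finset.range m, 1 / ‖w + ((i : ℂ) + 1)‖ ^ 2
      ≤ ∑ i ∈ Finset.range m, f ((i + 1 : ℕ) : ℝ) := Finset.sum_le_sum hterm
    _ = ∑ i ∈ Finset.Ico 0 m, f ((i + 1 : ℕ) : ℝ) := by rw [Finset.range_eq_Ico]
    _ ≤ ∫ u in ((0 : ℕ) : ℝ)..((m : ℕ) : ℝ), f u := AntitoneOn.sum_le_integral_Ico (Nat.zero_le m) hanti
    _ ≤ π / (2 * |w.im|) := by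
        simpa [hf] using integral_inv_sq_add_sq_le hy (Nat.cast_nonneg m)

/-- `log n − log ‖w + n‖ → 0`. [folklore] -/
lemma tendsto_log_nat_sub_log_norm_add (w : ℂ) :
    Tendsto (fun n : ℕ ↦ Real.log n - Real.log ‖w + n‖) atTop (𝓝 0) := by
  have h1 : Tendsto (fun n : ℕ ↦ w / n + 1) atTop (𝓝 (0 + 1)) :=
    (tendsto_const_div_atTop_nhds_zero_nat w).add tendsto_const_nhds
  rw [zero_add] at h1
  have h2 : Tendsto (fun n : ℕ ↦ Real.log ‖w / n + 1‖) atTop (𝓝 0) := by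
    have := ((Real.continuousAt_log (by simp : ‖(1 : ℂ)‖ ≠ 0)).tendsto.comp
      ((continuous_norm.tendsto _).comp h1))
    simpa [Function.comp_def] using this
  have h3 : ∀ᶠ n : ℕ in atTop, w / n + 1 ≠ 0 :=
    h1.eventually_ne one_ne_zero
  refine (tendsto_congr' ?_).1 (h2.neg.trans (by simp))
  filter_upwards [eventually_ne_atTop 0, h3] with n hn hne
  have hn' : (n : ℂ) ≠ 0 := Nat.cast_ne_zero.2 hn
  have hn0 : (0 : ℝ) < n := Nat.cast_pos.2 (Nat.pos_of_ne_zero hn)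
  have hwn : w + n = n * (w / n + 1) := by field_simp
  rw [hwn, norm_mul, Complex.norm_natCast, Real.log_mul hn0.ne' (norm_ne_zero_iff.2 hne)]
  ring

/-- **Stirling-type vertical bound for the digamma function.** For `0 < Re w` and `Im w ≠ 0`,
`|Re ψ(w) − log ‖w‖| ≤ 1/(2‖w‖²) + π/(4|Im w|)`. From Gauss's formula
`ψ(w) = lim (log n − Σ_{j≤n} 1/(w+j))`, comparing `Σ_{j<n} Re 1/(w+j)` with
`∫₀ⁿ Re 1/(w+u) du = log‖w+n‖ − log‖w‖` interval by interval. [folklore] -/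
theorem abs_re_digamma_sub_log_norm_le {w : ℂ} (hw : 0 < w.re) (hy : w.im ≠ 0) :
    |(digamma w).re - Real.log ‖w‖| ≤ 1 / (2 * ‖w‖ ^ 2) + π / (4 * |w.im|) := by
  set g : ℝ → ℝ := fun u ↦ (1 / (w + u)).re with hg
  set B : ℝ := 1 / (2 * ‖w‖ ^ 2) + π / (4 * |w.im|) with hB
  -- real part of Gauss's formula
  have ha : Tendsto (fun n : ℕ ↦ Real.log n - ∑ j ∈ Finset.range (n + 1), g j) atTop
      (𝓝 (digamma w).re) := by
    have := (continuous_re.tendsto _).comp (tendsto_log_sub_sum_inv_digamma hw)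
    refine this.congr fun n ↦ ?_
    simp only [Function.comp_apply, Complex.sub_re, Complex.ofReal_re, Complex.re_sum, g,
      Complex.ofReal_natCast]
  -- the comparison sequence
  set c : ℕ → ℝ := fun n ↦ Real.log n - Real.log ‖w + n‖ + Real.log ‖w‖ - g n with hc
  have hgn : Tendsto (fun n : ℕ ↦ g n) atTop (𝓝 0) := by
    have hle : ∀ n : ℕ, |g n| ≤ 1 / (w.re + n) := by
      intro n
      simp only [hg, re_one_div_add_ofReal]
      have hpos : 0 < w.re + n := by positivity
      rw [abs_of_nonneg (div_nonneg hpos.le (by positivity)), div_le_div_iff₀ (by positivity) hpos]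
      nlinarith [sq_nonneg w.im]
    have hlim : Tendsto (fun n : ℕ ↦ 1 / (w.re + n)) atTop (𝓝 0) := by
      have := tendsto_one_div_add_atTop_nhds_zero_nat (𝕜 := ℝ)
      -- 1/(n + re w): compare
      refine tendsto_const_nhds.div_atTop ?_
      exact tendsto_atTop_add_const_left _ _ tendsto_natCast_atTop_atTop
    exact squeeze_zero_norm (fun n ↦ by simpa [Real.norm_eq_abs] using hle n) hlim
  have hcl : Tendsto c atTop (𝓝 (Real.log ‖w‖)) := by
    have := ((tendsto_log_nat_sub_log_norm_add w).add
      (tendsto_const_nhds (x := Real.log ‖w‖))).sub hgn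
    simpa [hc] using this
  -- the key estimate
  have hkey : ∀ n : ℕ, |(Real.log n - ∑ j ∈ Finset.range (n + 1), g j) - c n| ≤ B := by
    intro n
    have hint : ∀ k < n, IntervalIntegrable g volume (k : ℕ) ((k + 1 : ℕ) : ℝ) := by
      intro k _
      refine (continuous_re.comp_continuousOn
        (ContinuousOn.div continuousOn_const (by fun_prop) ?_)).intervalIntegrable
      intro u hu h
      have hu0 : 0 ≤ u := by
        rcases mem_uIcc.1 hu with h' | h' <;> [linarith [h'.1]; (push_cast at h'; linarith [h'.1])]
      have := congrArg Complex.re h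
      simp at this
      linarith
    have hsum : ∑ k ∈ Finset.range n, ∫ u in (k : ℕ)..((k + 1 : ℕ) : ℝ), g u =
        Real.log ‖w + n‖ - Real.log ‖w‖ := by
      rw [intervalIntegral.sum_integral_adjacent_intervals hint, Nat.cast_zero]
      have h0 := integral_re_one_div_add hw le_rfl (Nat.cast_nonneg n)
      rw [Complex.ofReal_natCast, Complex.ofReal_zero, add_zero] at h0
      exact h0
    have hrew : (Real.log n - ∑ j ∈ Finset.range (n + 1), g j) - c n =
        -∑ k ∈ Finset.range n, (g k - ∫ u in (k : ℕ)..((k + 1 : ℕ) : ℝ), g u) := by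
      rw [Finset.sum_sub_distrib, hsum, Finset.sum_range_succ, hc]
      ring
    rw [hrew, abs_neg]
    calc |∑ k ∈ Finset.range n, (g k - ∫ u in (k : ℕ)..((k + 1 : ℕ) : ℝ), g u)|
        ≤ ∑ k ∈ Finset.range n, |g k - ∫ u in (k : ℕ)..((k + 1 : ℕ) : ℝ), g u| :=
          Finset.abs_sum_le_sum_abs _ _
      _ ≤ ∑ k ∈ Finset.range n, 1 / (2 * ‖w + k‖ ^ 2) := by
          refine Finset.sum_le_sum fun k _ ↦ ?_
          have := abs_re_one_div_sub_integral_le hw (Nat.cast_nonneg k)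
          simpa [hg] using this
      _ = (1 / 2) * ∑ k ∈ Finset.range n, 1 / ‖w + k‖ ^ 2 := by
          rw [Finset.mul_sum]
          refine Finset.sum_congr rfl fun k _ ↦ ?_
          ring
      _ ≤ (1 / 2) * (1 / ‖w‖ ^ 2 + π / (2 * |w.im|)) := by
          gcongr
          exact sum_inv_norm_add_sq_le hw hy n
      _ = B := by rw [hB]; ring
  -- pass to the limit
  have hlim := (ha.sub hcl).abs
  exact le_of_tendsto' hlim hkey

/-- Lower-bound form of `abs_re_digamma_sub_log_norm_le`:
`Re ψ(w) ≥ log ‖w‖ − 1/(2‖w‖²) − π/(4|Im w|)` (`0 < Re w`, `Im w ≠ 0`); this is the direction used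
for Levinson–Montgomery's (2.4). [folklore] -/
theorem log_norm_sub_le_re_digamma {w : ℂ} (hw : 0 < w.re) (hy : w.im ≠ 0) :
    Real.log ‖w‖ - (1 / (2 * ‖w‖ ^ 2) + π / (4 * |w.im|)) ≤ (digamma w).re := by
  have h := abs_re_digamma_sub_log_norm_le hw hy
  rw [abs_le] at h
  linarith [h.1]

/-- Upper-bound form of `abs_re_digamma_sub_log_norm_le`. [folklore] -/
theorem re_digamma_le_log_norm_add {w : ℂ} (hw : 0 < w.re) (hy : w.im ≠ 0) :
    (digamma w).re ≤ Real.log ‖w‖ + (1 / (2 * ‖w‖ ^ 2) + π / (4 * |w.im|)) := by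
  have h := abs_re_digamma_sub_log_norm_le hw hy
  rw [abs_le] at h
  linarith [h.2]

end Literature.Analysis.SpecialFunctions.Complex

end
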